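import Summits.HodgeConjecture.HodgeConjecture.Theorems.F0AlbCmS1LevelRealisation
import Literature.AlgebraicGeometry.HodgeTheory.HodgeTypeConjugation
import HarnessLib

/-!
# Crux `HLiu418`, line `F0_AlbCm` — M5-glue part 3, TYPED: the levelwise realisation OF A TRANSPORT with its Hodge types
# (p04՚s head (T2′) `levelRealisation_of_transport`, the `hL` of `F0AlbCmS1RealisationHodge.stub_S1_realisationHodge_of`)

Floor-0 programme P5 (Alb-CM), seat F0P5-p01 (g0); crux item stmt-HodgeConjecture-24832 (`HCCMUnconditional.HLiu418`).  THEOREMS ONLY,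
letter-free and `sorry`-free.  HC_CM is proved only modulo the 7 printed citations until rung 0 closes.  Parts 1–2 = ★
`Theorems/F0AlbCmS1OneZeroLift.lean`, ★ `Theorems/F0AlbCmS1LevelRealisation.lean` (untyped S1-R♭).
* §1 TYPED VANISHING of the `(1,0)`-lift map `Φ_K` of one level: if `ι_q^* z` is of Hodge type `(0,1)` on every piece then `Φ_K[z] = 0`
  (model independence ★ `IsOfHodgeType.mem_hodgePQ` ⇒ `π^{1,0}(ι_q^* z) = 0` ★ `typeProj_apply_of_mem_ne` ⇒ the form and its cone reads vanish ⇒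
  ★ M3 `lift_eq_zero_iff`); if `ι_q^* z` is of type `(1,0)` on every piece then `Φ_K[conj z] = 0` (★ `IsOfHodgeType.conjClass`,
  ★ `conjClass_complexBetti_map`).
* §2 the four TYPED MEMBERSHIP clauses of `f⁰_K[z] = Φ_K[z] + conj Φ_K[conj z]`, by cases on Mathlib's embedding `e♮` of the place of `τ`
  (★ F2-V `lift_mem_holCotForms₂_of_embedding_eq` ∕ `conjFun₂_lift_mem_holCotForms₂_of_embedding_ne`).
* §3 **`levelRealisation_of_transport`**: for ANY injective Hecke-natural transport `tr_K : H¹_B(A_K)_{ι₁} → H¹((M_K ⊗_{ι₁} ℂ)(ℂ); ℂ)`,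
  `f_K := f⁰_K ∘ tr_K` is `cohForms₂`-valued, injective, Hecke-compatible (parts 1–2) AND typed: a class tested `(1,0)` (resp. `(0,1)`) on every
  smooth projective test variety over `M_K ⊗ ℂ` goes to `holCotForms₂ 𝔣` (resp. its conjugate) when `e♮ = ι₁`, and the other way round when
  `e♮ ≠ ι₁` — the statement p04 (g0) asked for as `hL` (`F0/P5/p04/HEAD-levelRealisation_of_transport.wanted…`, up to definitional unfolding).
[cite: Liu2021, §D.2–§D.3 l. 5300–5359 and §4.2 l. 2066–2081] [cite: VoisinHodgeI2002, §6.1.3 Cor. 6.12, Prop. 6.11 and §7.1.1]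
[cite: Borel1997, §5.13–§5.14] [cite: BorelWallach2000, VII 2.10 and 3.6] [cite: BorelJacquet1979, §4.3]
-/

set_option autoImplicit false
set_option linter.dupNamespace false

noncomputable section

open Function MulAction Topology NumberField CategoryTheory Matrix AlgebraicGeometry
open scoped Matrix ComplexOrder Manifold
open Literature.AlgebraicGeometry.Motives
open Literature.NumberTheory.Automorphic Literature.NumberTheory.Automorphic.UnitaryGroup
open Literature.NumberTheory.Automorphic.UnitaryCurveForms
open Literature.NumberTheory.Automorphic.Liu2021.AppendixC (C5.OpenCompactSubgroup C5.SmallLevel)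
open Literature.AlgebraicGeometry.HodgeTheory
open Literature.Geometry.Kaehler (MForm)
open Literature.AlgebraicTopology.SingularHomology
open Literature.AlgebraicGeometry.ShimuraVarieties Literature.AlgebraicGeometry.ShimuraVarieties.UnitaryCanonicalModel
open Summit.HodgeConjecture.HodgeConjecture.Cruxes.HLiu418.S1OneZeroLift
open Summit.HodgeConjecture.HodgeConjecture.Cruxes.HLiu418.S1LevelRealisation

namespace Summit.HodgeConjecture.HodgeConjecture.Cruxes.HLiu418.S1LevelRealisationTyped

variable {L : Type} [Field L] [NumberField L] [IsCMField L] {Jstar : Matrix (Fin 2) (Fin 2) L} {τ : L →+* ℂ}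
  {K₀ : C5.OpenCompactSubgroup ↥(finAdelic (↥(maximalRealSubfield L)) L (IsCMField.complexConj L) 2 Jstar)}
  {S : RecordSystemGS L Jstar τ K₀} {K : C5.SmallLevel K₀}
  {gq : orbitRel.Quotient ↥(rational (↥(maximalRealSubfield L)) L (IsCMField.complexConj L) 2 Jstar)
          (ShimuraDissection.CosetSpace (rationalToFinAdelic (↥(maximalRealSubfield L)) L (IsCMField.complexConj L) 2 Jstar) K.1.1) →
    ↥(finAdelic (↥(maximalRealSubfield L)) L (IsCMField.complexConj L) 2 Jstar)}
  {X : orbitRel.Quotient ↥(rational (↥(maximalRealSubfield L)) L (IsCMField.complexConj L) 2 Jstar)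
          (ShimuraDissection.CosetSpace (rationalToFinAdelic (↥(maximalRealSubfield L)) L (IsCMField.complexConj L) 2 Jstar) K.1.1) →
    SchemeOver ℂ}
  {ι : ∀ q, X q ⟶ (letI : Algebra L ℂ := τ.toAlgebra; (Literature.AlgebraicGeometry.Motives.baseChangeHom τ).obj (S.M.obj K))}
  {B : ∀ q, UnitaryBallUniformisationDatum 1 (X q)}

/-! ## §1 Typed vanishing of the `(1,0)`-lift map -/

set_option maxHeartbeats 1600000 in
/-- **A class of type `(0,1)` on every piece has `(1,0)`-lift `0`**: `π^{1,0}(ι_q^* z) = 0` in the algebraic Hodge model of the piece (model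
independence of the Hodge types, ★ `IsOfHodgeType.mem_hodgePQ`), so the `(1,0)`-form `ω_q(ι_q^* z)` and all its cone reads vanish, hence the
lift (★ M3 `lift_eq_zero_iff`). [cite: VoisinHodgeI2002, Prop. 6.11 and §7.1.1] [cite: BorelJacquet1979, §4.3] -/
theorem oneZeroLiftMap_eq_zero_of_zeroOne
    (hgq : ∀ q, Quotient.mk'' (ShimuraDissection.CosetSpace.pt
      (rationalToFinAdelic (↥(maximalRealSubfield L)) L (IsCMField.complexConj L) 2 Jstar) K.1.1 (gq q)) = q)
    {v₀ : Fin 2 → ℂ} (t₀ : Fin 2 → ℂ)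
    {Φ : letI : Algebra L ℂ := τ.toAlgebra
      complexBetti ((Literature.AlgebraicGeometry.Motives.baseChangeHom τ).obj (S.M.obj K)) 1 →ₗ[ℂ] ((adelicGroupData (↥(maximalRealSubfield L)) L (IsCMField.complexConj L) 2 Jstar).Adelic → ℂ)}
    (hΦ : letI : Algebra L ℂ := τ.toAlgebra
      ∀ z : complexBetti ((Literature.AlgebraicGeometry.Motives.baseChangeHom τ).obj (S.M.obj K)) 1,
        (∀ (δ : ↥(rational (↥(maximalRealSubfield L)) L (IsCMField.complexConj L) 2 Jstar)) (x : (adelicGroupData (↥(maximalRealSubfield L)) L (IsCMField.complexConj L) 2 Jstar).Adelic),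
          Φ z ((adelicGroupData (↥(maximalRealSubfield L)) L (IsCMField.complexConj L) 2 Jstar).toAdelic δ * x) = Φ z x) ∧
        (∀ k ∈ ((archAt (↥(maximalRealSubfield L)) L (IsCMField.complexConj L) 2 Jstar (cmPlace L τ)
              (UnitaryGroup.complexConj_smul_infinitePlace L _) (IsCMField.complexConj_ne_one L)).ker).map
            (archToAdelic (↥(maximalRealSubfield L)) L (IsCMField.complexConj L) 2 Jstar),
          ∀ x : (adelicGroupData (↥(maximalRealSubfield L)) L (IsCMField.complexConj L) 2 Jstar).Adelic, Φ z (x * k) = Φ z x) ∧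
        (∀ k ∈ K.1.1, ∀ x : (adelicGroupData (↥(maximalRealSubfield L)) L (IsCMField.complexConj L) 2 Jstar).Adelic,
          Φ z (x * finAdelicToAdelic (↥(maximalRealSubfield L)) L (IsCMField.complexConj L) 2 Jstar k) = Φ z x) ∧
        ∀ (q : orbitRel.Quotient ↥(rational (↥(maximalRealSubfield L)) L (IsCMField.complexConj L) 2 Jstar)
          (ShimuraDissection.CosetSpace (rationalToFinAdelic (↥(maximalRealSubfield L)) L (IsCMField.complexConj L) 2 Jstar) K.1.1))
          (u : archLocal L 2 Jstar (cmPlace L τ)),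
          Φ z (adelicSingle (↥(maximalRealSubfield L)) L (IsCMField.complexConj L) 2 Jstar (IsCMField.complexConj_ne_one L)
              (UnitaryGroup.complexConj_smul_infinitePlace L) (cmPlace L τ) u *
            finAdelicToAdelic (↥(maximalRealSubfield L)) L (IsCMField.complexConj L) 2 Jstar (gq q)) =
          (((algebraicModel (B q).isSmoothProjective).oneFormOfClass (B q).isSmoothProjective (algebraicModel (B q).isSmoothProjective).holFormsClosed_top (((algebraicModel (B q).isSmoothProjective).complexification (B q).isSmoothProjective 1).symm ((algebraicModel (B q).isSmoothProjective).pullbackEquiv 1 ((algebraicModel (B q).isSmoothProjective).typeProj 1 ⟨(1, 0), Finset.HasAntidiagonal.mem_antidiagonal.2 rfl⟩ (complexBetti.map (ι q) 1 z)))) : MForm 𝓘(ℝ, (algebraicModel (B q).isSmoothProjective).model) (algebraicModel (B q).isSmoothProjective).carrier ℂ 1)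
          ((⇑(algebraicModel (B q).isSmoothProjective).isAnalytification.homeomorph.symm ∘ (B q).unif)
            ((((u : GL (Fin 2) ℂ) : Matrix (Fin 2) (Fin 2) ℂ).map (embTwist L τ)) *ᵥ v₀))
          (fun _ ↦ mfderiv 𝓘(ℝ, Fin 2 → ℂ) 𝓘(ℝ, (algebraicModel (B q).isSmoothProjective).model)
            (⇑(algebraicModel (B q).isSmoothProjective).isAnalytification.homeomorph.symm ∘ (B q).unif)
            ((((u : GL (Fin 2) ℂ) : Matrix (Fin 2) (Fin 2) ℂ).map (embTwist L τ)) *ᵥ v₀)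
            ((((u : GL (Fin 2) ℂ) : Matrix (Fin 2) (Fin 2) ℂ).map (embTwist L τ)) *ᵥ t₀))))
    {z : letI : Algebra L ℂ := τ.toAlgebra; complexBetti ((Literature.AlgebraicGeometry.Motives.baseChangeHom τ).obj (S.M.obj K)) 1}
    (hz : ∀ q, Literature.AlgebraicGeometry.HodgeTheory.IsOfHodgeType 1 (X q) 1 0 1 (complexBetti.map (ι q) 1 z)) :
    Φ z = 0 := by
  letI : Algebra L ℂ := τ.toAlgebra
  have hcov := cover_of_representatives (K := K.1.1) (hgq := hgq)
  refine (lift_eq_zero_iff hcov (hΦ z).1 (hΦ z).2.1 (hΦ z).2.2.1 (hΦ z).2.2.2).2 fun q u => ?_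
  have hmem : complexBetti.map (ι q) 1 z ∈
      (algebraicModel (B q).isSmoothProjective).typePiece 1 ⟨(0, 1), Finset.HasAntidiagonal.mem_antidiagonal.2 rfl⟩ :=
    ((algebraicModel (B q).isSmoothProjective).mem_typePiece_iff _ _).2 ((hz q).mem_hodgePQ (B q).isSmoothProjective _)
  have h0 : (algebraicModel (B q).isSmoothProjective).typeProj 1 ⟨(1, 0), Finset.HasAntidiagonal.mem_antidiagonal.2 rfl⟩
      (complexBetti.map (ι q) 1 z) = 0 :=
    (algebraicModel (B q).isSmoothProjective).typeProj_apply_of_mem_ne (fun h => by cases h) hmem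
  rw [h0, map_zero, map_zero, map_zero, ZeroMemClass.coe_zero]
  rfl

set_option maxHeartbeats 1600000 in
/-- **A class of type `(1,0)` on every piece has `Φ_K[conj z] = 0`**: `conj` of a `(1,0)`-class is a `(0,1)`-class (★ `IsOfHodgeType.conjClass`)
and commutes with `ι_q^*` (★ `conjClass_complexBetti_map`). [cite: VoisinHodgeI2002, §6.1.3 Cor. 6.12] -/
theorem oneZeroLiftMap_conjClass_eq_zero_of_oneZero
    (hgq : ∀ q, Quotient.mk'' (ShimuraDissection.CosetSpace.pt
      (rationalToFinAdelic (↥(maximalRealSubfield L)) L (IsCMField.complexConj L) 2 Jstar) K.1.1 (gq q)) = q)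
    {v₀ : Fin 2 → ℂ} (t₀ : Fin 2 → ℂ)
    {Φ : letI : Algebra L ℂ := τ.toAlgebra
      complexBetti ((Literature.AlgebraicGeometry.Motives.baseChangeHom τ).obj (S.M.obj K)) 1 →ₗ[ℂ] ((adelicGroupData (↥(maximalRealSubfield L)) L (IsCMField.complexConj L) 2 Jstar).Adelic → ℂ)}
    (hΦ : letI : Algebra L ℂ := τ.toAlgebra
      ∀ z : complexBetti ((Literature.AlgebraicGeometry.Motives.baseChangeHom τ).obj (S.M.obj K)) 1,
        (∀ (δ : ↥(rational (↥(maximalRealSubfield L)) L (IsCMField.complexConj L) 2 Jstar)) (x : (adelicGroupData (↥(maximalRealSubfield L)) L (IsCMField.complexConj L) 2 Jstar).Adelic),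
          Φ z ((adelicGroupData (↥(maximalRealSubfield L)) L (IsCMField.complexConj L) 2 Jstar).toAdelic δ * x) = Φ z x) ∧
        (∀ k ∈ ((archAt (↥(maximalRealSubfield L)) L (IsCMField.complexConj L) 2 Jstar (cmPlace L τ)
              (UnitaryGroup.complexConj_smul_infinitePlace L _) (IsCMField.complexConj_ne_one L)).ker).map
            (archToAdelic (↥(maximalRealSubfield L)) L (IsCMField.complexConj L) 2 Jstar),
          ∀ x : (adelicGroupData (↥(maximalRealSubfield L)) L (IsCMField.complexConj L) 2 Jstar).Adelic, Φ z (x * k) = Φ z x) ∧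
        (∀ k ∈ K.1.1, ∀ x : (adelicGroupData (↥(maximalRealSubfield L)) L (IsCMField.complexConj L) 2 Jstar).Adelic,
          Φ z (x * finAdelicToAdelic (↥(maximalRealSubfield L)) L (IsCMField.complexConj L) 2 Jstar k) = Φ z x) ∧
        ∀ (q : orbitRel.Quotient ↥(rational (↥(maximalRealSubfield L)) L (IsCMField.complexConj L) 2 Jstar)
          (ShimuraDissection.CosetSpace (rationalToFinAdelic (↥(maximalRealSubfield L)) L (IsCMField.complexConj L) 2 Jstar) K.1.1))
          (u : archLocal L 2 Jstar (cmPlace L τ)),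
          Φ z (adelicSingle (↥(maximalRealSubfield L)) L (IsCMField.complexConj L) 2 Jstar (IsCMField.complexConj_ne_one L)
              (UnitaryGroup.complexConj_smul_infinitePlace L) (cmPlace L τ) u *
            finAdelicToAdelic (↥(maximalRealSubfield L)) L (IsCMField.complexConj L) 2 Jstar (gq q)) =
          (((algebraicModel (B q).isSmoothProjective).oneFormOfClass (B q).isSmoothProjective (algebraicModel (B q).isSmoothProjective).holFormsClosed_top (((algebraicModel (B q).isSmoothProjective).complexification (B q).isSmoothProjective 1).symm ((algebraicModel (B q).isSmoothProjective).pullbackEquiv 1 ((algebraicModel (B q).isSmoothProjective).typeProj 1 ⟨(1, 0), Finset.HasAntidiagonal.mem_antidiagonal.2 rfl⟩ (complexBetti.map (ι q) 1 z)))) : MForm 𝓘(ℝ, (algebraicModel (B q).isSmoothProjective).model) (algebraicModel (B q).isSmoothProjective).carrier ℂ 1)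
          ((⇑(algebraicModel (B q).isSmoothProjective).isAnalytification.homeomorph.symm ∘ (B q).unif)
            ((((u : GL (Fin 2) ℂ) : Matrix (Fin 2) (Fin 2) ℂ).map (embTwist L τ)) *ᵥ v₀))
          (fun _ ↦ mfderiv 𝓘(ℝ, Fin 2 → ℂ) 𝓘(ℝ, (algebraicModel (B q).isSmoothProjective).model)
            (⇑(algebraicModel (B q).isSmoothProjective).isAnalytification.homeomorph.symm ∘ (B q).unif)
            ((((u : GL (Fin 2) ℂ) : Matrix (Fin 2) (Fin 2) ℂ).map (embTwist L τ)) *ᵥ v₀)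
            ((((u : GL (Fin 2) ℂ) : Matrix (Fin 2) (Fin 2) ℂ).map (embTwist L τ)) *ᵥ t₀))))
    {z : letI : Algebra L ℂ := τ.toAlgebra; complexBetti ((Literature.AlgebraicGeometry.Motives.baseChangeHom τ).obj (S.M.obj K)) 1}
    (hz : ∀ q, Literature.AlgebraicGeometry.HodgeTheory.IsOfHodgeType 1 (X q) 1 1 0 (complexBetti.map (ι q) 1 z)) :
    letI : Algebra L ℂ := τ.toAlgebra
    Φ (conjClass _ 1 z) = 0 := by
  letI : Algebra L ℂ := τ.toAlgebra
  refine oneZeroLiftMap_eq_zero_of_zeroOne hgq t₀ hΦ fun q => ?_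
  rw [← conjClass_complexBetti_map]
  exact (hz q).conjClass (B q).isSmoothProjective

/-! ## §2 The four typed membership clauses of `f⁰_K[z] = Φ_K[z] + conj Φ_K[conj z]` -/

set_option maxHeartbeats 1600000 in
/-- **Typed membership**: with `e♮` Mathlib's embedding of the place of `τ`: if `e♮ = τ`, a class `(1,0)` on every piece goes to `holCotForms₂ 𝔣`
and a class `(0,1)` on every piece to `conj (holCotForms₂ 𝔣)`; if `e♮ ≠ τ`, the other way round (★ F2-V `lift_mem_holCotForms₂_of_embedding_eq` ∕
`conjFun₂_lift_mem_holCotForms₂_of_embedding_ne` and §1). [cite: Borel1997, §5.13–§5.14] [cite: BorelWallach2000, VII 2.10]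
[cite: VoisinHodgeI2002, §7.1.1] -/
theorem addConj_mem_typed
    (hgq : ∀ q, Quotient.mk'' (ShimuraDissection.CosetSpace.pt
      (rationalToFinAdelic (↥(maximalRealSubfield L)) L (IsCMField.complexConj L) 2 Jstar) K.1.1 (gq q)) = q)
    (hB : ∀ q, (B q).Hℂ = Jstar.map τ) (𝔣 : ConeFrame L Jstar (cmPlace L τ))
    {Φ : letI : Algebra L ℂ := τ.toAlgebra
      complexBetti ((Literature.AlgebraicGeometry.Motives.baseChangeHom τ).obj (S.M.obj K)) 1 →ₗ[ℂ] ((adelicGroupData (↥(maximalRealSubfield L)) L (IsCMField.complexConj L) 2 Jstar).Adelic → ℂ)}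
    (hΦ : letI : Algebra L ℂ := τ.toAlgebra
      ∀ z : complexBetti ((Literature.AlgebraicGeometry.Motives.baseChangeHom τ).obj (S.M.obj K)) 1,
        let v₀ : Fin 2 → ℂ := fun i => embTwist L τ (𝔣.v₀ i)
        let t₀ : Fin 2 → ℂ := fun i => embTwist L τ (𝔣.t₀ i)
        (∀ (δ : ↥(rational (↥(maximalRealSubfield L)) L (IsCMField.complexConj L) 2 Jstar)) (x : (adelicGroupData (↥(maximalRealSubfield L)) L (IsCMField.complexConj L) 2 Jstar).Adelic),
          Φ z ((adelicGroupData (↥(maximalRealSubfield L)) L (IsCMField.complexConj L) 2 Jstar).toAdelic δ * x) = Φ z x) ∧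
        (∀ k ∈ ((archAt (↥(maximalRealSubfield L)) L (IsCMField.complexConj L) 2 Jstar (cmPlace L τ)
              (UnitaryGroup.complexConj_smul_infinitePlace L _) (IsCMField.complexConj_ne_one L)).ker).map
            (archToAdelic (↥(maximalRealSubfield L)) L (IsCMField.complexConj L) 2 Jstar),
          ∀ x : (adelicGroupData (↥(maximalRealSubfield L)) L (IsCMField.complexConj L) 2 Jstar).Adelic, Φ z (x * k) = Φ z x) ∧
        (∀ k ∈ K.1.1, ∀ x : (adelicGroupData (↥(maximalRealSubfield L)) L (IsCMField.complexConj L) 2 Jstar).Adelic,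
          Φ z (x * finAdelicToAdelic (↥(maximalRealSubfield L)) L (IsCMField.complexConj L) 2 Jstar k) = Φ z x) ∧
        ∀ (q : orbitRel.Quotient ↥(rational (↥(maximalRealSubfield L)) L (IsCMField.complexConj L) 2 Jstar)
          (ShimuraDissection.CosetSpace (rationalToFinAdelic (↥(maximalRealSubfield L)) L (IsCMField.complexConj L) 2 Jstar) K.1.1))
          (u : archLocal L 2 Jstar (cmPlace L τ)),
          Φ z (adelicSingle (↥(maximalRealSubfield L)) L (IsCMField.complexConj L) 2 Jstar (IsCMField.complexConj_ne_one L)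
              (UnitaryGroup.complexConj_smul_infinitePlace L) (cmPlace L τ) u *
            finAdelicToAdelic (↥(maximalRealSubfield L)) L (IsCMField.complexConj L) 2 Jstar (gq q)) =
          (((algebraicModel (B q).isSmoothProjective).oneFormOfClass (B q).isSmoothProjective (algebraicModel (B q).isSmoothProjective).holFormsClosed_top (((algebraicModel (B q).isSmoothProjective).complexification (B q).isSmoothProjective 1).symm ((algebraicModel (B q).isSmoothProjective).pullbackEquiv 1 ((algebraicModel (B q).isSmoothProjective).typeProj 1 ⟨(1, 0), Finset.HasAntidiagonal.mem_antidiagonal.2 rfl⟩ (complexBetti.map (ι q) 1 z)))) : MForm 𝓘(ℝ, (algebraicModel (B q).isSmoothProjective).model) (algebraicModel (B q).isSmoothProjective).carrier ℂ 1)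
          ((⇑(algebraicModel (B q).isSmoothProjective).isAnalytification.homeomorph.symm ∘ (B q).unif)
            ((((u : GL (Fin 2) ℂ) : Matrix (Fin 2) (Fin 2) ℂ).map (embTwist L τ)) *ᵥ v₀))
          (fun _ ↦ mfderiv 𝓘(ℝ, Fin 2 → ℂ) 𝓘(ℝ, (algebraicModel (B q).isSmoothProjective).model)
            (⇑(algebraicModel (B q).isSmoothProjective).isAnalytification.homeomorph.symm ∘ (B q).unif)
            ((((u : GL (Fin 2) ℂ) : Matrix (Fin 2) (Fin 2) ℂ).map (embTwist L τ)) *ᵥ v₀)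
            ((((u : GL (Fin 2) ℂ) : Matrix (Fin 2) (Fin 2) ℂ).map (embTwist L τ)) *ᵥ t₀))))
    (z : letI : Algebra L ℂ := τ.toAlgebra; complexBetti ((Literature.AlgebraicGeometry.Motives.baseChangeHom τ).obj (S.M.obj K)) 1) :
    letI : Algebra L ℂ := τ.toAlgebra
    ((cmPlace L τ).1.embedding = τ →
      ((∀ q, Literature.AlgebraicGeometry.HodgeTheory.IsOfHodgeType 1 (X q) 1 1 0 (complexBetti.map (ι q) 1 z)) →
          Φ z + conjFun₂ (↥(maximalRealSubfield L)) L (IsCMField.complexConj L) Jstar (Φ (conjClass _ 1 z)) ∈ holCotForms₂ (↥(maximalRealSubfield L)) L (IsCMField.complexConj L) Jstar (IsCMField.complexConj_ne_one L) (UnitaryGroup.complexConj_smul_infinitePlace L) (cmPlace L τ) 𝔣) ∧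
        ((∀ q, Literature.AlgebraicGeometry.HodgeTheory.IsOfHodgeType 1 (X q) 1 0 1 (complexBetti.map (ι q) 1 z)) →
          Φ z + conjFun₂ (↥(maximalRealSubfield L)) L (IsCMField.complexConj L) Jstar (Φ (conjClass _ 1 z)) ∈ (holCotForms₂ (↥(maximalRealSubfield L)) L (IsCMField.complexConj L) Jstar (IsCMField.complexConj_ne_one L) (UnitaryGroup.complexConj_smul_infinitePlace L) (cmPlace L τ) 𝔣).map (conjFun₂ (↥(maximalRealSubfield L)) L (IsCMField.complexConj L) Jstar))) ∧
    ((cmPlace L τ).1.embedding ≠ τ →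
      ((∀ q, Literature.AlgebraicGeometry.HodgeTheory.IsOfHodgeType 1 (X q) 1 1 0 (complexBetti.map (ι q) 1 z)) →
          Φ z + conjFun₂ (↥(maximalRealSubfield L)) L (IsCMField.complexConj L) Jstar (Φ (conjClass _ 1 z)) ∈ (holCotForms₂ (↥(maximalRealSubfield L)) L (IsCMField.complexConj L) Jstar (IsCMField.complexConj_ne_one L) (UnitaryGroup.complexConj_smul_infinitePlace L) (cmPlace L τ) 𝔣).map (conjFun₂ (↥(maximalRealSubfield L)) L (IsCMField.complexConj L) Jstar)) ∧
        ((∀ q, Literature.AlgebraicGeometry.HodgeTheory.IsOfHodgeType 1 (X q) 1 0 1 (complexBetti.map (ι q) 1 z)) →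
          Φ z + conjFun₂ (↥(maximalRealSubfield L)) L (IsCMField.complexConj L) Jstar (Φ (conjClass _ 1 z)) ∈ holCotForms₂ (↥(maximalRealSubfield L)) L (IsCMField.complexConj L) Jstar (IsCMField.complexConj_ne_one L) (UnitaryGroup.complexConj_smul_infinitePlace L) (cmPlace L τ) 𝔣)) := by
  letI : Algebra L ℂ := τ.toAlgebra
  have hcov := cover_of_representatives (K := K.1.1) (hgq := hgq)
  have h10 : (∀ q, Literature.AlgebraicGeometry.HodgeTheory.IsOfHodgeType 1 (X q) 1 1 0 (complexBetti.map (ι q) 1 z)) →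
      Φ (conjClass _ 1 z) = 0 := fun h => oneZeroLiftMap_conjClass_eq_zero_of_oneZero hgq _ hΦ h
  have h01 : (∀ q, Literature.AlgebraicGeometry.HodgeTheory.IsOfHodgeType 1 (X q) 1 0 1 (complexBetti.map (ι q) 1 z)) →
      Φ z = 0 := fun h => oneZeroLiftMap_eq_zero_of_zeroOne hgq _ hΦ h
  have hhol_eq : (InfinitePlace.mk τ).embedding = τ → ∀ w : complexBetti ((Literature.AlgebraicGeometry.Motives.baseChangeHom τ).obj (S.M.obj K)) 1, Φ w ∈ holCotForms₂ (↥(maximalRealSubfield L)) L (IsCMField.complexConj L) Jstar (IsCMField.complexConj_ne_one L) (UnitaryGroup.complexConj_smul_infinitePlace L) (cmPlace L τ) 𝔣 := fun hemb w =>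
    lift_mem_holCotForms₂_of_embedding_eq hemb 𝔣 (coneFrame_v₀_eq L Jstar τ 𝔣) (coneFrame_t₀_eq L Jstar τ 𝔣) hB
      (fun q => algebraicModel (B q).isSmoothProjective)
      (fun q => ((algebraicModel (B q).isSmoothProjective).oneFormOfClass (B q).isSmoothProjective (algebraicModel (B q).isSmoothProjective).holFormsClosed_top (((algebraicModel (B q).isSmoothProjective).complexification (B q).isSmoothProjective 1).symm ((algebraicModel (B q).isSmoothProjective).pullbackEquiv 1 ((algebraicModel (B q).isSmoothProjective).typeProj 1 ⟨(1, 0), Finset.HasAntidiagonal.mem_antidiagonal.2 rfl⟩ (complexBetti.map (ι q) 1 w)))) : MForm 𝓘(ℝ, (algebraicModel (B q).isSmoothProjective).model) (algebraicModel (B q).isSmoothProjective).carrier ℂ 1))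
      (fun q => Literature.Geometry.Kaehler.isHolomorphicInCharts_of_mem _) hcov (hΦ w).1 (hΦ w).2.1 (hΦ w).2.2.1 (hΦ w).2.2.2
  have hhol_ne : (InfinitePlace.mk τ).embedding ≠ τ → ∀ w : complexBetti ((Literature.AlgebraicGeometry.Motives.baseChangeHom τ).obj (S.M.obj K)) 1, conjFun₂ (↥(maximalRealSubfield L)) L (IsCMField.complexConj L) Jstar (Φ w) ∈ holCotForms₂ (↥(maximalRealSubfield L)) L (IsCMField.complexConj L) Jstar (IsCMField.complexConj_ne_one L) (UnitaryGroup.complexConj_smul_infinitePlace L) (cmPlace L τ) 𝔣 := fun hemb w =>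
    conjFun₂_lift_mem_holCotForms₂_of_embedding_ne hemb 𝔣 (coneFrame_v₀_eq L Jstar τ 𝔣) (coneFrame_t₀_eq L Jstar τ 𝔣) hB
      (fun q => algebraicModel (B q).isSmoothProjective)
      (fun q => ((algebraicModel (B q).isSmoothProjective).oneFormOfClass (B q).isSmoothProjective (algebraicModel (B q).isSmoothProjective).holFormsClosed_top (((algebraicModel (B q).isSmoothProjective).complexification (B q).isSmoothProjective 1).symm ((algebraicModel (B q).isSmoothProjective).pullbackEquiv 1 ((algebraicModel (B q).isSmoothProjective).typeProj 1 ⟨(1, 0), Finset.HasAntidiagonal.mem_antidiagonal.2 rfl⟩ (complexBetti.map (ι q) 1 w)))) : MForm 𝓘(ℝ, (algebraicModel (B q).isSmoothProjective).model) (algebraicModel (B q).isSmoothProjective).carrier ℂ 1))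
      (fun q => Literature.Geometry.Kaehler.isHolomorphicInCharts_of_mem _) hcov (hΦ w).1 (hΦ w).2.1 (hΦ w).2.2.1 (hΦ w).2.2.2
  refine ⟨fun hemb => ⟨fun h => ?_, fun h => ?_⟩, fun hemb => ⟨fun h => ?_, fun h => ?_⟩⟩
  · rw [h10 h, map_zero, add_zero]
    exact hhol_eq hemb z
  · rw [h01 h, zero_add]
    exact Submodule.mem_map.2 ⟨_, hhol_eq hemb _, rfl⟩
  · rw [h10 h, map_zero, add_zero]
    exact Submodule.mem_map.2 ⟨_, hhol_ne hemb z, conjFun₂_conjFun₂ _ _ _ _ (Φ z)⟩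
  · rw [h01 h, zero_add]
    exact hhol_ne hemb _

/-! ## §3 The typed levelwise realisation of a transport (T2′) -/

section Fold

open Summit.HodgeConjecture.CorCM (CMField)
open Summit.HodgeConjecture.CorCM.Lines.A3Liu418
open Literature.NumberTheory.Automorphic.Liu2021 Literature.NumberTheory.Automorphic.Liu2021.AppendixC

set_option maxHeartbeats 1600000 in
/-- **(T2′) `levelRealisation_of_transport`** — for ANY injective, Hecke-natural transport `tr` of the GS Betti levels into the record levels
`H¹((M_K ⊗_{ι₁} ℂ)(ℂ); ℂ)` (e.g. ★ M5-tr `exists_bettiLevelRecordTransport`, or its typed twin ★ `exists_bettiLevelRecordTransport_hodge`),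
`f_K := (Φ_K + conj ∘ Φ_K ∘ conj) ∘ tr_K` is a `cohForms₂ 𝔣`-valued, injective, Hecke-compatible AND TYPED realisation: (V) ★ `addConj_mem_cohForms₂`,
(I) ★ `eq_zero_of_addConj_eq_zero`, (H) ★ `addConj_heckePullback` at ★ `isHeckeTranslate_recordHeckeTranslateGS`, types by `addConj_mem_typed` at
the pieces `Z := X_q`, `φ := ι_q` (smooth projective curves).  This is the `hL` of p04՚s `stub_S1_realisationHodge_of`.
[cite: Liu2021, §D.2–§D.3 l. 5300–5359 and §4.2 l. 2066–2081] [cite: VoisinHodgeI2002, §7.1.1] [cite: Borel1997, §5.14] [cite: BorelWallach2000, XIII 1.2] -/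
theorem levelRealisation_of_transport
    (F : CMField) (ι₁ : F →+* ℂ) (Jstar : Matrix (Fin 2) (Fin 2) (F : Type))
    (K₀ : C5.OpenCompactSubgroup ↥(finAdelic ↥(maximalRealSubfield (F : Type)) (F : Type) (IsCMField.complexConj (F : Type)) 2 Jstar))
    (S : RecordSystemGS (F : Type) Jstar ι₁ K₀) (hU7ₛ : S.HeckeTranslateDefinedOver)
    (h4 : 4 ≤ Module.finrank ℚ (F : Type)) (isoₛ : ℕ → Prop)
    (𝔣 : ConeFrame (F : Type) Jstar (cmPlace (F : Type) ι₁))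
    (tr : ∀ K : C5.SmallLevel K₀,
      (sec42DataGS S h4 isoₛ).bettiH1 ι₁ K →ₗ[ℂ] complexBetti ((Literature.AlgebraicGeometry.Motives.baseChangeHom ι₁).obj (S.M.obj K)) 1)
    (htr : ∀ K, Function.Injective (tr K))
    (htrH : ∀ (g : (sec42DataGS S h4 isoₛ).G) (K K' : C5.SmallLevel K₀) (h : C5.HeckeLE g K K')
        (y : (sec42DataGS S h4 isoₛ).bettiH1 ι₁ K'),
        tr K (bettiPullAlong ι₁ ((sec42HeckeTranslatesGS S hU7ₛ h4 isoₛ).albTr g K K' h) y) =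
          (complexBetti.map ((Literature.AlgebraicGeometry.Motives.baseChangeHom ι₁).map (recordHeckeTranslateGS S hU7ₛ g K K' h)) 1).hom
            (tr K' y)) :
    ∃ f : ∀ K : C5.SmallLevel K₀,
        (sec42DataGS S h4 isoₛ).bettiH1 ι₁ K →ₗ[ℂ]
          ((adelicGroupData ↥(maximalRealSubfield (F : Type)) (F : Type) (IsCMField.complexConj (F : Type)) 2 Jstar).Adelic → ℂ),
      (∀ (K : C5.SmallLevel K₀) (y : (sec42DataGS S h4 isoₛ).bettiH1 ι₁ K),
          f K y ∈ cohForms₂ ↥(maximalRealSubfield (F : Type)) (F : Type) (IsCMField.complexConj (F : Type)) Jstar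
            (IsCMField.complexConj_ne_one (F : Type)) (UnitaryGroup.complexConj_smul_infinitePlace (F : Type)) (cmPlace (F : Type) ι₁) 𝔣) ∧
      (∀ K : C5.SmallLevel K₀, Function.Injective (f K)) ∧
      (∀ (g : (sec42DataGS S h4 isoₛ).G) (K K' : C5.SmallLevel K₀) (h : C5.HeckeLE g K K')
          (y : (sec42DataGS S h4 isoₛ).bettiH1 ι₁ K'),
          f K (bettiPullAlong ι₁ ((sec42HeckeTranslatesGS S hU7ₛ h4 isoₛ).albTr g K K' h) y) =
            rightRep₂ ↥(maximalRealSubfield (F : Type)) (F : Type) (IsCMField.complexConj (F : Type)) Jstar g (f K' y)) ∧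
      ∀ (K : C5.SmallLevel K₀) (y : (sec42DataGS S h4 isoₛ).bettiH1 ι₁ K),
        ((cmPlace (F : Type) ι₁).1.embedding = ι₁ →
          ((∀ (Z : SchemeOver ℂ) (d : ℕ), IsSmoothProjective d Z → ∀ φ : Z ⟶ (Literature.AlgebraicGeometry.Motives.baseChangeHom ι₁).obj (S.M.obj K),
                Literature.AlgebraicGeometry.HodgeTheory.IsOfHodgeType d Z 1 1 0 ((complexBetti.map φ 1).hom (tr K y))) →
            f K y ∈ holCotForms₂ ↥(maximalRealSubfield (F : Type)) (F : Type) (IsCMField.complexConj (F : Type)) Jstar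
              (IsCMField.complexConj_ne_one (F : Type)) (UnitaryGroup.complexConj_smul_infinitePlace (F : Type)) (cmPlace (F : Type) ι₁) 𝔣) ∧
          ((∀ (Z : SchemeOver ℂ) (d : ℕ), IsSmoothProjective d Z → ∀ φ : Z ⟶ (Literature.AlgebraicGeometry.Motives.baseChangeHom ι₁).obj (S.M.obj K),
                Literature.AlgebraicGeometry.HodgeTheory.IsOfHodgeType d Z 1 0 1 ((complexBetti.map φ 1).hom (tr K y))) →
            f K y ∈ (holCotForms₂ ↥(maximalRealSubfield (F : Type)) (F : Type) (IsCMField.complexConj (F : Type)) Jstar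
              (IsCMField.complexConj_ne_one (F : Type)) (UnitaryGroup.complexConj_smul_infinitePlace (F : Type)) (cmPlace (F : Type) ι₁) 𝔣).map (conjFun₂ ↥(maximalRealSubfield (F : Type)) (F : Type) (IsCMField.complexConj (F : Type)) Jstar))) ∧
        ((cmPlace (F : Type) ι₁).1.embedding ≠ ι₁ →
          ((∀ (Z : SchemeOver ℂ) (d : ℕ), IsSmoothProjective d Z → ∀ φ : Z ⟶ (Literature.AlgebraicGeometry.Motives.baseChangeHom ι₁).obj (S.M.obj K),
                Literature.AlgebraicGeometry.HodgeTheory.IsOfHodgeType d Z 1 1 0 ((complexBetti.map φ 1).hom (tr K y))) →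
            f K y ∈ (holCotForms₂ ↥(maximalRealSubfield (F : Type)) (F : Type) (IsCMField.complexConj (F : Type)) Jstar
              (IsCMField.complexConj_ne_one (F : Type)) (UnitaryGroup.complexConj_smul_infinitePlace (F : Type)) (cmPlace (F : Type) ι₁) 𝔣).map (conjFun₂ ↥(maximalRealSubfield (F : Type)) (F : Type) (IsCMField.complexConj (F : Type)) Jstar)) ∧
          ((∀ (Z : SchemeOver ℂ) (d : ℕ), IsSmoothProjective d Z → ∀ φ : Z ⟶ (Literature.AlgebraicGeometry.Motives.baseChangeHom ι₁).obj (S.M.obj K),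
                Literature.AlgebraicGeometry.HodgeTheory.IsOfHodgeType d Z 1 0 1 ((complexBetti.map φ 1).hom (tr K y))) →
            f K y ∈ holCotForms₂ ↥(maximalRealSubfield (F : Type)) (F : Type) (IsCMField.complexConj (F : Type)) Jstar
              (IsCMField.complexConj_ne_one (F : Type)) (UnitaryGroup.complexConj_smul_infinitePlace (F : Type)) (cmPlace (F : Type) ι₁) 𝔣)) := by
  classical
  -- pieces at every level (★ `RecordSystemGS.pieces`)
  choose gq hgq X ι hcol B hB using S.pieces
  -- the `(1,0)`-lift maps at every level (part 1), frame untwisted to `ι₁`-coordinates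
  have hlift := fun K : C5.SmallLevel K₀ =>
    exists_oneZeroLiftMap (S := S) (ι := ι K) (B := B K) (hgq K) (fun q => ⟨(hB K q).1, (hB K q).2.1⟩)
      (embTwist_v₀_mem_negCone (F : Type) Jstar ι₁ 𝔣) (fun i => embTwist (F : Type) ι₁ (𝔣.t₀ i))
  choose Φ hΦ using hlift
  -- `f⁰_K = Φ_K + conj ∘ Φ_K ∘ conj` as linear maps
  have hf0 := fun K : C5.SmallLevel K₀ => exists_addConj_linearMap (Jstar := Jstar) (Φ K)
  choose f₀ hf₀ using hf0
  refine ⟨fun K => (f₀ K).comp (tr K), fun K y => ?_, fun K => ?_, fun g K K' h y => ?_, fun K y => ?_⟩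
  · -- (V)
    rw [LinearMap.comp_apply, hf₀]
    exact addConj_mem_cohForms₂ (hgq K) (fun q => (hB K q).1) 𝔣 (hΦ K) _
  · -- (I)
    show Function.Injective ((f₀ K).comp (tr K))
    rw [LinearMap.coe_comp]
    refine Function.Injective.comp ((injective_iff_map_eq_zero (f₀ K)).2 fun z hz => ?_) (htr K)
    rw [hf₀] at hz
    exact eq_zero_of_addConj_eq_zero (hgq K) (hcol K) (fun q => ⟨(hB K q).1, (hB K q).2.1⟩) 𝔣 (hΦ K) hz
  · -- (H)
    rw [LinearMap.comp_apply, LinearMap.comp_apply, htrH, hf₀, hf₀]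
    exact addConj_heckePullback (isHeckeTranslate_recordHeckeTranslateGS S hU7ₛ g K K' h) h (hgq K) (hgq K') (hB K) (hB K') 𝔣
      (hΦ K') (hΦ K) (tr K' y)
  · -- types, tested on the pieces (smooth projective curves)
    have ht := addConj_mem_typed (hgq K) (fun q => (hB K q).1) 𝔣 (hΦ K) (tr K y)
    simp only [LinearMap.comp_apply, hf₀]
    exact ⟨fun he => ⟨fun hT => (ht.1 he).1 fun q => hT (X K q) 1 (B K q).isSmoothProjective (ι K q),
        fun hT => (ht.1 he).2 fun q => hT (X K q) 1 (B K q).isSmoothProjective (ι K q)⟩,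
      fun he => ⟨fun hT => (ht.2 he).1 fun q => hT (X K q) 1 (B K q).isSmoothProjective (ι K q),
        fun hT => (ht.2 he).2 fun q => hT (X K q) 1 (B K q).isSmoothProjective (ι K q)⟩⟩

end Fold

end Summit.HodgeConjecture.HodgeConjecture.Cruxes.HLiu418.S1LevelRealisationTyped
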